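import Literature.Computability.Complexity.OracleLazyTables
import Mathlib.Probability.ProbabilityMassFunction.Constructions
import HarnessLib

/-!
# Lazy sampling of a random table, II: supplies as product distributions

Continuation of `OracleLazyTables.lean` (`TableSpec`, the eager oracle `tableOracle`, the lazy run
`lazyAux`, and the counting identity `card_run_tableOracle_mul_eq`). The probability-side toolkit
the GGM hybrids are written in:

* `TableSpec.lazyAux_map_supply` — reading the supply through a map `f : V' → V` is the lazy run of
  the spec whose answers first apply `f` (`TableSpec.comapVal`): "supply the seeds and expand them on
  demand" equals "supply the expanded blocks";
* `prodPMF μs` — the law of a list of INDEPENDENT samples, one from each `μ ∈ μs` (`PMF` monad);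
  `prodPMF_replicate_uniform` (i.i.d. uniform values are a uniform tuple, read through `List.ofFn`),
  `prodPMF_map`, `support` lengths, and **`prodPMF_replicate_bind_mixAt`** — replacing position `i` of
  an i.i.d. list by an independent sample `a ← ν` (the other positions read through maps `φ₁`, `φ₂`
  before/after `i`) yields the product law with `ν` at position `i`: the one identity behind
  "the distinguisher plants its input sample at a position of the supply";
* uniform distributions: `uniformOfFintype_map_equiv` (transport along a bijection),
  `uniformOfFintype_prod` (a uniform pair is two independent uniform coordinates), and the bridges
  from the `PMF` monad to counting, `toReal_uniform_map_apply` and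
  `toReal_uniform_bind_uniform_map_apply`.

## Library fit

`prodPMF` generalises the tree's i.i.d. list laws — `Learning/PAC.lean` `iidList μ t`
(`= prodPMF (List.replicate t μ)`, same recursion) and the `Fin`-tuple variant `iidPMF` of
`Cryptography/LWE.lean` — to HETEROGENEOUS factors, which the right-hand side of
`prodPMF_replicate_bind_mixAt` needs; `prodPMF_replicate_uniform` is statement-for-statement
`PACUniformCoins.lean`'s `iidList_uniformOfFintype`. The uniform-distribution helpers
`uniformOfFintype_map_equiv` / `uniformOfFintype_prod` are copies of
`Cryptography/PseudorandomFunctionsPneNPProofs.lean` (`PRGfromPRF`, ll. 154, 162; further transport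
copies in `LWERegevTransforms.lean`, `InformationTheory/Coding/DualDistance.lean`,
`SamplingProblemsUniform.lean`). This file sits below all of them in the import order (only
`Oracle.lean` and Mathlib), so it is the natural survivor: `refactor:` those files should import these
and drop their copies (and `Learning/PAC.lean` may bridge `iidList μ t = prodPMF (replicate t μ)`); no
import from above the complexity core is taken here.

## References

* O. Goldreich, *Foundations of Cryptography I*, CUP 2001 [Goldreich2001], Thm. 3.6.6 (proof: the
  algorithm `D` "places the two halves of `α_i`", Claim 3.6.6.1) and Thm. 3.2.6 (independent samples).
* S. Arora, B. Barak, *Computational Complexity*, CUP 2009 [AroraBarak2009], Def. 7.1 (independent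
  segments of the random tape).
-/

namespace Literature.Computability.Complexity

open _root_.Computability Finset LazyTable

variable {β K V V' : Type}

/-! ### Reading the supply through a map -/

namespace TableSpec

/-- The spec whose stored values are `V'`, answered after applying `f : V' → V`. [folklore] -/
def comapVal (S : TableSpec K V) (f : V' → V) : TableSpec K V' where
  key := S.key
  ans := fun q v' => S.ans q (f v')
  ans₀ := S.ans₀

/-- Lookup commutes with mapping the stored values. [folklore] -/
theorem assocFind_map [DecidableEq K] (f : V' → V) (κ : K) :
    ∀ tbl : List (K × V'), assocFind κ (tbl.map (Prod.map id f)) = (assocFind κ tbl).map f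
  | [] => rfl
  | (κ', v) :: tl => by
    rw [List.map_cons, Prod.map_apply, id, assocFind_cons, assocFind_cons, assocFind_map f κ tl]
    split_ifs <;> rfl

/-- **Supplying expanded values equals expanding supplied values**: the lazy run of `S` on the supply
`s.map f` (with the table mapped accordingly) is the lazy run of `S.comapVal f` on `s`, as long as the
supply lasts. [cite: Goldreich2001, Thm. 3.6.6 (proof: "putting the two halves of the pseudorandom strings at level k+1 has exactly the same effect")] -/
theorem lazyAux_map_supply [DecidableEq K] [Inhabited V] [Inhabited V'] (S : TableSpec K V) (f : V' → V)
    (M : OracleAlg β) (x : List Bool) :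
    ∀ (m : ℕ) (as : List (List Bool)) (tbl : List (K × V')) (s : List V'), m ≤ s.length →
      S.lazyAux M x m as (tbl.map (Prod.map id f)) (s.map f) = (S.comapVal f).lazyAux M x m as tbl s
  | 0, _, _, _, _ => rfl
  | m + 1, as, tbl, s, hs => by
    obtain ⟨v, s', rfl⟩ : ∃ v s', s = v :: s' := by
      cases s with
      | nil => simp at hs
      | cons v s' => exact ⟨v, s', rfl⟩
    have hs' : m ≤ s'.length := by simpa using hs
    rw [lazyAux_succ, lazyAux_succ]
    cases hstep : M.step x as with
    | inr b => rfl
    | inl q =>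
      simp only [comapVal, List.map_cons, List.tail_cons, List.headI_cons, assocFind_map]
      cases hk : S.key q with
      | none =>
        dsimp only
        exact lazyAux_map_supply S f M x m _ tbl s' hs'
      | some κ =>
        dsimp only
        cases hf : assocFind κ tbl with
        | some w =>
          simp only [Option.map_some]
          exact lazyAux_map_supply S f M x m _ tbl s' hs'
        | none =>
          simp only [Option.map_none]
          have h := lazyAux_map_supply S f M x m (as ++ [S.ans q (f v)]) (tbl ++ [(κ, v)]) s' hs'
          rw [List.map_append, List.map_singleton] at h
          exact h

end TableSpec

/-! ### Uniform distributions: transport, products, counting -/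

section Uniform

variable {A B γ Ω : Type}

/-- **Transport of the uniform distribution along a bijection.** [folklore] -/
theorem uniformOfFintype_map_equiv [Fintype A] [Fintype B] [Nonempty A] [Nonempty B] (e : A ≃ B) :
    (PMF.uniformOfFintype A).map e = PMF.uniformOfFintype B := by
  ext b
  rw [PMF.map_apply, tsum_eq_single (e.symm b)]
  · rw [if_pos (e.apply_symm_apply b).symm, PMF.uniformOfFintype_apply, PMF.uniformOfFintype_apply,
      Fintype.card_congr e]
  · intro a ha
    rw [if_neg]
    intro h
    apply ha
    rw [h, Equiv.symm_apply_apply]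

/-- **A uniform pair is two independent uniform coordinates.** [folklore] -/
theorem uniformOfFintype_prod [Fintype A] [Fintype B] [Nonempty A] [Nonempty B] :
    PMF.uniformOfFintype (A × B) =
      (PMF.uniformOfFintype A).bind fun a => (PMF.uniformOfFintype B).map (Prod.mk a) := by
  ext ⟨a, b⟩
  rw [PMF.uniformOfFintype_apply, PMF.bind_apply, tsum_eq_single a]
  · rw [PMF.map_apply, tsum_eq_single b]
    · rw [if_pos rfl, PMF.uniformOfFintype_apply, PMF.uniformOfFintype_apply, Fintype.card_prod,
        Nat.cast_mul, ENNReal.mul_inv (Or.inl (Nat.cast_ne_zero.2 Fintype.card_ne_zero))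
          (Or.inl (ENNReal.natCast_ne_top _))]
    · intro b' hb'
      rw [if_neg]
      intro h
      exact hb' (Prod.mk.inj h).2.symm
  · intro a' ha'
    rw [PMF.map_apply, ENNReal.tsum_eq_zero.2, mul_zero]
    intro b'
    rw [if_neg]
    intro h
    exact ha' (Prod.mk.inj h).1.symm

/-- **Counting form of a push-forward of the uniform distribution**: the mass of `c` under
`F(uniform ω)` is `#{ω | F ω = c} / |Ω|`. [folklore] -/
theorem toReal_uniform_map_apply [Fintype Ω] [Nonempty Ω] [DecidableEq γ] (F : Ω → γ) (c : γ) :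
    ((PMF.uniformOfFintype Ω).map F c).toReal = ((univ.filter fun ω => F ω = c).card : ℝ) / Fintype.card Ω := by
  classical
  rw [PMF.map_apply, tsum_fintype]
  simp only [PMF.uniformOfFintype_apply]
  rw [← Finset.sum_filter, Finset.sum_const, nsmul_eq_mul, ENNReal.toReal_mul, ENNReal.toReal_natCast,
    ENNReal.toReal_inv, ENNReal.toReal_natCast, div_eq_mul_inv,
    Finset.filter_congr (s := univ) (fun ω _ => (eq_comm : c = F ω ↔ F ω = c))]

/-- **Counting form of a `bind` of two uniform distributions**: the mass of `c` under
`F(uniform a, uniform b)` is `#{(a, b) | F a b = c} / (|A| · |B|)`. [folklore] -/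
theorem toReal_uniform_bind_uniform_map_apply [Fintype A] [Fintype B] [Nonempty A] [Nonempty B]
    [DecidableEq γ] (F : A → B → γ) (c : γ) :
    (((PMF.uniformOfFintype A).bind fun a => (PMF.uniformOfFintype B).map (F a)) c).toReal =
      ((univ.filter fun p : A × B => F p.1 p.2 = c).card : ℝ) / (Fintype.card A * Fintype.card B) := by
  have h : ((PMF.uniformOfFintype A).bind fun a => (PMF.uniformOfFintype B).map (F a)) =
      (PMF.uniformOfFintype (A × B)).map fun p => F p.1 p.2 := by
    rw [uniformOfFintype_prod, PMF.map_bind]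
    refine congrArg _ (funext fun a => ?_)
    rw [PMF.map_comp]
    rfl
  rw [h, toReal_uniform_map_apply, Fintype.card_prod, Nat.cast_mul]

end Uniform

/-! ### Product distributions on lists -/

section ProdPMF

variable {α γ : Type}

/-- `prodPMF μs`: the law of a list of independent samples, the `j`-th drawn from `μs[j]`. [folklore] -/
noncomputable def prodPMF : List (PMF α) → PMF (List α)
  | [] => PMF.pure []
  | μ :: μs => μ.bind fun a => (prodPMF μs).map fun l => a :: l

/-- No factors: the point mass at `ε`. [folklore] -/
@[simp] theorem prodPMF_nil : prodPMF ([] : List (PMF α)) = PMF.pure [] := rfl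

/-- One more factor. [folklore] -/
theorem prodPMF_cons (μ : PMF α) (μs : List (PMF α)) :
    prodPMF (μ :: μs) = μ.bind fun a => (prodPMF μs).map fun l => a :: l := rfl

/-- Samples of `prodPMF μs` have the length of `μs`. [folklore] -/
theorem length_eq_of_mem_support_prodPMF : ∀ {μs : List (PMF α)} {l : List α},
    l ∈ (prodPMF μs).support → l.length = μs.length
  | [], l, h => by
    rw [prodPMF_nil, PMF.support_pure, Set.mem_singleton_iff] at h
    rw [h]
    rfl
  | μ :: μs, l, h => by
    rw [prodPMF_cons, PMF.mem_support_bind_iff] at h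
    obtain ⟨a, -, ha⟩ := h
    rw [PMF.mem_support_map_iff] at ha
    obtain ⟨l', hl', rfl⟩ := ha
    rw [List.length_cons, List.length_cons, length_eq_of_mem_support_prodPMF hl']

/-- **Mapping every sample**: `prodPMF (μs.map (map f)) = (prodPMF μs).map (map f)`. [folklore] -/
theorem prodPMF_map (f : α → γ) : ∀ μs : List (PMF α),
    prodPMF (μs.map (PMF.map f)) = (prodPMF μs).map (List.map f)
  | [] => by rw [List.map_nil, prodPMF_nil, prodPMF_nil, PMF.pure_map]; rfl
  | μ :: μs => by
    rw [List.map_cons, prodPMF_cons, prodPMF_cons, PMF.map_bind, PMF.bind_map]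
    refine congrArg _ (funext fun a => ?_)
    rw [Function.comp_apply, prodPMF_map f μs, PMF.map_comp, PMF.map_comp]
    rfl

/-- **I.i.d. uniform values are a uniform tuple** (read as a list through `List.ofFn`). [folklore] -/
theorem prodPMF_replicate_uniform [Fintype V] [Nonempty V] : ∀ t : ℕ,
    prodPMF (List.replicate t (PMF.uniformOfFintype V)) =
      (PMF.uniformOfFintype (Fin t → V)).map List.ofFn
  | 0 => by
    rw [List.replicate_zero, prodPMF_nil]
    have h : (List.ofFn : (Fin 0 → V) → List V) = fun _ => [] := funext fun _ => List.ofFn_zero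
    rw [h]
    exact (PMF.map_const _ _).symm
  | t + 1 => by
    rw [List.replicate_succ, prodPMF_cons, prodPMF_replicate_uniform t,
      ← uniformOfFintype_map_equiv (Fin.consEquiv fun _ => V), uniformOfFintype_prod, PMF.map_bind, PMF.map_bind]
    refine congrArg _ (funext fun v => ?_)
    rw [PMF.map_comp, PMF.map_comp, PMF.map_comp]
    refine congrArg (fun f => (PMF.uniformOfFintype (Fin t → V)).map f) (funext fun g => ?_)
    exact (List.ofFn_cons v g).symm

/-- `mixAt φ₁ φ₂ i a l`: the list `l` with position `i` replaced by `a`, earlier entries read through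
`φ₁`, later ones through `φ₂`. [folklore] -/
def mixAt (φ₁ φ₂ : α → γ) : ℕ → γ → List α → List γ
  | _, _, [] => []
  | 0, a, _ :: l => a :: l.map φ₂
  | i + 1, a, b :: l => φ₁ b :: mixAt φ₁ φ₂ i a l

/-- `mixAt` at position `0`. [folklore] -/
@[simp] theorem mixAt_zero_cons (φ₁ φ₂ : α → γ) (a : γ) (b : α) (l : List α) :
    mixAt φ₁ φ₂ 0 a (b :: l) = a :: l.map φ₂ := rfl

/-- `mixAt` at a later position. [folklore] -/
@[simp] theorem mixAt_succ_cons (φ₁ φ₂ : α → γ) (i : ℕ) (a : γ) (b : α) (l : List α) :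
    mixAt φ₁ φ₂ (i + 1) a (b :: l) = φ₁ b :: mixAt φ₁ φ₂ i a l := rfl

/-- **Planting an independent sample**: if `l` has i.i.d. entries of law `μ` (`t` of them) and `a ← ν`
is independent, then `mixAt φ₁ φ₂ i a l` has independent entries of laws
`μ∘φ₁⁻¹, …, μ∘φ₁⁻¹ (i times), ν, μ∘φ₂⁻¹, …` (`t - i - 1` times), for `i < t`.
[cite: Goldreich2001, Thm. 3.2.6 (proof: the hybrid H^i_n with the given sample planted at position i)] -/
theorem prodPMF_replicate_bind_mixAt (μ : PMF α) (ν : PMF γ) (φ₁ φ₂ : α → γ) :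
    ∀ (i t : ℕ), i < t →
      ((prodPMF (List.replicate t μ)).bind fun l => ν.map fun a => mixAt φ₁ φ₂ i a l) =
        prodPMF (List.replicate i (μ.map φ₁) ++ ν :: List.replicate (t - i - 1) (μ.map φ₂))
  | i, 0, h => absurd h (Nat.not_lt_zero _)
  | 0, t + 1, _ => by
    rw [List.replicate_succ, prodPMF_cons, PMF.bind_bind]
    have h : ∀ b : α, (((prodPMF (List.replicate t μ)).map fun l => b :: l).bind fun l =>
        ν.map fun a => mixAt φ₁ φ₂ 0 a l) =
        (prodPMF (List.replicate t μ)).bind fun l => ν.bind (PMF.pure ∘ fun a => a :: l.map φ₂) := by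
      intro b
      rw [PMF.bind_map]
      rfl
    simp_rw [h]
    rw [PMF.bind_const, PMF.bind_comm]
    have hm : prodPMF (List.replicate t (μ.map φ₂)) = (prodPMF (List.replicate t μ)).map (List.map φ₂) := by
      rw [← prodPMF_map, List.map_replicate]
    rw [List.replicate_zero, List.nil_append, show t + 1 - 0 - 1 = t by omega, prodPMF_cons, hm]
    refine congrArg _ (funext fun a => ?_)
    show (prodPMF (List.replicate t μ)).bind (PMF.pure ∘ fun l => a :: l.map φ₂) = _
    rw [PMF.bind_pure_comp, PMF.map_comp]
    rfl
  | i + 1, t + 1, h => by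
    have ih := prodPMF_replicate_bind_mixAt μ ν φ₁ φ₂ i t (Nat.lt_of_succ_lt_succ h)
    rw [List.replicate_succ, prodPMF_cons, PMF.bind_bind, List.replicate_succ, List.cons_append,
      prodPMF_cons, PMF.bind_map, Nat.succ_sub_succ]
    refine congrArg _ (funext fun b => ?_)
    rw [PMF.bind_map, Function.comp_apply, ← ih, PMF.map_bind]
    refine congrArg _ (funext fun l => ?_)
    rw [Function.comp_apply, PMF.map_comp]
    rfl

end ProdPMF

end Literature.Computability.Complexity
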